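import Summits.Ventures.GridStability.Models.NE39SP39DroopQV
import Summits.Ventures.GridStability.Models.NE39SP39DroopQVDeflateBlocks1
import Summits.Ventures.GridStability.Models.NE39SP39DroopQVDeflateBlocks2
import Summits.Ventures.GridStability.Models.NE39SP39DroopQVDeflateBlocks3
import Summits.Ventures.GridStability.Models.NE39SP39DroopQVDeflateBlocks4
import Summits.Ventures.GridStability.Models.NE39SP39DroopQVDeflateBlocks5
import Summits.Ventures.GridStability.Models.DroopQVDeflateSparse
import Summits.Ventures.GridStability.Models.DroopQVDeflation
import Summits.Ventures.GridStability.Models.NE39LossyLinearisation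
import Literature.Computation.Certificates.PsdRoundedTwin
import Literature.Computation.Certificates.PosSemidefIntList

/-!
# GridStability/Models/NE39SP39DroopQVDeflate — ★ candidate #108-cand «G3.b-ss-DROOPQV-NE39SP39-RATE»: the OPERATOR-SIZE RATE certificate (117 states, reduction-free) — every non-rotation eigenvalue of the `117 × 117` linearisation of «DROOPQV-NE39SP39» has `Re z < −1`

Cell `gridfusion` (LADDER-GRIDFUSION, APEX LINE rung G3.b; seat gridfusion-model-8 (g3); lead g8 RULING 9n (1), ★ #68's rule A-less B ∧ D ∧ L ∧ R1 ∧ R2).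
The deflation lane of `Models/DroopQVDeflation.lean` (p530169: data `ζ`, `J′ = J + r ζᵀ`, certificates `S ≻ 0` and `H = S(−J′) + (S(−J′))ᵀ − 2r₀S ≻ 0` ⇒
every complex eigenpair of `J = jacMatrix (θ*, V*)` is the rotation mode or has `Re z < −r₀`; no Jordan chain at `0`) on the 39-unit instance
`NE39SP39.droopQV` (`Models/NE39SP39DroopQV.lean`), by the SPARSE / INTEGER / PD-BY-CONSTRUCTION lane of `Models/DroopQVDeflateSparse.lean`, data in
`Models/NE39SP39DroopQVDeflateData.lean`. Everything the kernel evaluates is LOCAL (a row block never needs another block's rows):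
* §0 `J̃/2^40` (sparse integer model `Jt`) is within `2^−41` of the instance's exact `jacQx` ENTRYWISE (`Jt_close`): the kernel evaluates `jacQx` only on
  the 39 + 92 adjacent-or-equal unit pairs (`Jt_close_adj`); elsewhere both vanish (`jacQx_far`, `Jt_far`);
* §1 `ζ = −𝟙_θ` (`γ = −39 < −1`); the deflated Jacobian as an EXPRESSION `defl117JQ` (bridge `droopQV_jacDefl_eq`, no evaluation);
* §2 `S := L̃L̃ᵀ/2^40` — `S ≻ 0` STRUCTURAL (`DeflRows.posDef_gramRowsLT_div`: triangular, nonzero diagonal — `Lt_tri`), NO PSD certificate;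
* §3 TWENTY block checks (`blocks`, rows `6c … 6c+5`, one `decide +kernel` each, in `…DeflateBlocks1–5.lean`): the kernel computes the block's rows of `S·2^40 = L̃L̃ᵀ` (mirrored
  ragged dots) and of `T_ℤ = L̃L̃ᵀ·(J̃ + 2^40·1) + 2^40(L̃L̃ᵀ r)ζᵀ = 2^80·T′_model` by sparse integer accumulation, and checks `|T_ℤ − 2^80·T̃| ≤ 2^79`
  and `Σ_j |(L̃L̃ᵀ)_ij| ≤ ρ_ℤ = 899305659333324796000` — cost `≈ 117·602` integer multiply-adds + `≈ 117³/3` factor products IN TOTAL;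
* §4 propositional assembly: `|T′ − T̃| ≤ 1/2 + ρ_ℤ/2^81 ≤ 1` with `T′ = S·(J′ + 1)` EXACT (`DeflRows.abs_mul_sub_mul_le`, Rump's argument
  [cite: Rump1999VerifiedLargeSystems, §4]); `H = −(T′ + T′ᵀ)`; the symmetric integer twin `M = −(T̃ + T̃ᵀ) − 235·1` (`DeflRows.twinHRows`, computed) is
  DIAGONALLY DOMINANT (margin ≥ 1296; trivial Gram factor) and `|(H − 1) − (M + 234·1)| ≤ 2` entrywise ⇒ (lit-5
  `PSD.quadForm_nonneg_of_roundedTwin_of_close`, `117·2 ≤ 234`) `H − 1·1 ⪰ 0` ⇒ `H ≻ 0`;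
* §5 transport by `e117` and the two certified statements.
RESULT. `NE39SP39.droopQV_eig_re_lt`: every complex eigenpair `(z, v)` of the `117 × 117` `jacMatrix (θ*, V*)` of `NE39SP39.droopQV.toMicrogrid` is the
ROTATION MODE (`z = 0`, `v ∈ ℂ·[𝟙; 0; 0]`) or has `Re z < −1`; `droopQV_no_jordan_chain_at_zero` (with the first: `0` is algebraically simple).
Informative floats (VALIDATED only, `gen/sp39.py`, Hessenberg–QR): non-rotation abscissa of `J` ≈ `-1.00169` s⁻¹ (slowest pairs `−1.0017 ± 42.57i`,
`−1.0042 ± 48.33i`), fastest real modes ≈ `−397`, `−301`. KERNEL COST (memo §3/§5 datum; measured farm walls in the STAGED line): `O(N·nnz(J) + N³/3)`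
integer work in 20 local blocks (five files) instead of `2N³` rational multiply-adds + an `N³/3` dense Gram certificate (g2 sizing 20–40 kernel-min).
THREE COLUMNS. CERTIFIED (kernel): matrix statements about the MODEL `NE39SP39.droopQV.toMicrogrid` (N1 with Q–V). MODELLED: MV-6N — SYNTHETIC/CONSTRUCTION
census object (39 all-inverter buses on the printed New England branch reactances [cite: Padiyar2013, App. D], gains [cite: KunduEtAl2019, §V], `G = 0`,
no shunts, no loads, set-points defined); NOT a sentence about the New England system, any microgrid or any converter; never a region of attraction.
VALIDATED: the float Lyapunov solve behind `L̃`, the float spectrum. No sentence of this file says a grid, a microgrid or a converter is stable.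
-/

set_option maxRecDepth 100000

noncomputable section

open Real Matrix Finset
open scoped ComplexOrder
open Literature.Computation.Certificates

namespace Summit.Ventures.GridStability.Models

open DeflRows

namespace NE39SP39

/-! ## §0 The state index, adjacency, and the INTEGER MODEL of the sparse Jacobian (kernel-checked to `2^−41`) -/

/-- The state index `Fin 39 ⊕ (Fin 39 ⊕ Fin 39)` as `Fin 117` (angles `0–38`, frequencies `39–77`, voltages `78–116`). [folklore] -/
def e117 : Fin 39 ⊕ (Fin 39 ⊕ Fin 39) ≃ Fin 117 := (Equiv.sumCongr (Equiv.refl (Fin 39)) finSumFinEquiv).trans finSumFinEquiv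

/-- The unit carrying a state coordinate. [folklore] -/
def unitOf : Fin 39 ⊕ (Fin 39 ⊕ Fin 39) → Fin 39 := Sum.elim id (Sum.elim id id)

/-- Adjacency-or-equality of two units in the branch graph (Bool, from the literal `Boff`). [folklore] -/
def adj (i j : Fin 39) : Bool := decide (i = j) || !decide (Boff i j = 0)

/-- **Structural zeros**: for two distinct NON-adjacent units every Jacobian block entry vanishes (`G = 0`, `B_ij = 0`). [folklore] -/
theorem jacQx_far (a b : Fin 39 ⊕ (Fin 39 ⊕ Fin 39)) (h : adj (unitOf a) (unitOf b) = false) : droopQV.jacQx a b = 0 := by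
  have h' : unitOf a ≠ unitOf b ∧ Boff (unitOf a) (unitOf b) = 0 := by
    simpa [adj] using h
  obtain ⟨hne, hB⟩ := h'
  have hBB : droopQV.B (unitOf a) (unitOf b) = 0 := by
    show B (unitOf a) (unitOf b) = 0
    simp [B, hne, hB]
  have hG : droopQV.G (unitOf a) (unitOf b) = 0 := rfl
  rcases a with i | i | i <;> rcases b with j | j | j <;>
    simp only [unitOf, Sum.elim_inl, Sum.elim_inr, id] at hne hBB hG ⊢ <;>
    simp [DroopQVData.jacQx, DroopQVData.PθQ, DroopQVData.PVQ, DroopQVData.QθQ, DroopQVData.QVQ, DroopQVData.aPQ,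
      DroopQVData.aQQ, DroopQVData.dgPQ, DroopQVData.gPQ, DroopQVData.gQQ, hne, Ne.symm hne, hBB, hG]

/-- The exact Jacobian, flattened (EXPRESSION, never tabulated). [folklore] -/
def JflatQ : Matrix (Fin 117) (Fin 117) ℚ := fun i j => droopQV.jacQx (e117.symm i) (e117.symm j)

/-- The integer model as a rational matrix `J̃/2^40`. [folklore] -/
def JtQ : Matrix (Fin 117) (Fin 117) ℚ := fun i j => ((matrixOfSparseRows 117 117 Jt i j : ℤ) : ℚ) / 1099511627776

/-- Model closeness on the ADJACENT-or-equal unit pairs (the kernel evaluates `jacQx` only here). [folklore] -/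
theorem Jt_close_adj : ∀ a b : Fin 39 ⊕ (Fin 39 ⊕ Fin 39), adj (unitOf a) (unitOf b) = true →
    |droopQV.jacQx a b - ((matrixOfSparseRows 117 117 Jt (e117 a) (e117 b) : ℤ) : ℚ) / 1099511627776| ≤ (1 : ℚ) / 2199023255552 := by
  unfold DroopQVData.jacQx DroopQVData.PθQ DroopQVData.PVQ DroopQVData.QθQ DroopQVData.QVQ
  decide +kernel

/-- The model has no entry on NON-adjacent unit pairs. [folklore] -/
theorem Jt_far : ∀ a b : Fin 39 ⊕ (Fin 39 ⊕ Fin 39), adj (unitOf a) (unitOf b) = false →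
    matrixOfSparseRows 117 117 Jt (e117 a) (e117 b) = 0 := by decide +kernel

/-- **`|J − J̃/2^40| ≤ 2^−41` entrywise** on the flat index. CERTIFIED. [folklore] -/
theorem Jt_close (i j : Fin 117) : |JflatQ i j - JtQ i j| ≤ (1 : ℚ) / 2199023255552 := by
  have key : ∀ a b : Fin 39 ⊕ (Fin 39 ⊕ Fin 39),
      |droopQV.jacQx a b - ((matrixOfSparseRows 117 117 Jt (e117 a) (e117 b) : ℤ) : ℚ) / 1099511627776| ≤ (1 : ℚ) / 2199023255552 := by
    intro a b
    by_cases h : adj (unitOf a) (unitOf b) = true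
    · exact Jt_close_adj a b h
    · have h' : adj (unitOf a) (unitOf b) = false := by simpa using h
      rw [Jt_far a b h', jacQx_far a b h']
      norm_num
  have h := key (e117.symm i) (e117.symm j)
  simpa only [JflatQ, JtQ, Equiv.apply_symm_apply] using h

/-! ## §1 Deflation data and the deflated Jacobian (expression) -/

/-- Deflation data `ζ = −𝟙` on the angle block (rational). [folklore] -/
def zetaQ : Fin 39 ⊕ (Fin 39 ⊕ Fin 39) → ℚ := Sum.elim (fun _ => (-1 : ℚ)) (Sum.elim 0 0)

/-- The same data over `ℝ`. [folklore] -/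
def zeta : Fin 39 ⊕ (Fin 39 ⊕ Fin 39) → ℝ := Sum.elim (fun _ => (-1 : ℝ)) (Sum.elim 0 0)

/-- The rotation vector `r = [𝟙; 0; 0]` (rational). [folklore] -/
def rotVecQ : Fin 39 ⊕ (Fin 39 ⊕ Fin 39) → ℚ := Sum.elim (fun _ => (1 : ℚ)) (Sum.elim 0 0)

/-- `r` flattened (integer list): `1` on indices `< 39`. [folklore] -/
def rZ : List ℤ := (List.finRange 117).map fun i : Fin 117 => if i.val < 39 then 1 else 0

/-- `2^40·ζ` flattened (integer list): `−2^40` on indices `< 39`. [folklore] -/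
def zZ : List ℤ := (List.finRange 117).map fun i : Fin 117 => if i.val < 39 then -1099511627776 else 0

/-- The flattened rank-one term `(r ζᵀ)_ij` (rational EXPRESSION). [folklore] -/
def RQ : Matrix (Fin 117) (Fin 117) ℚ := fun i j => Matrix.vecMulVec rotVecQ zetaQ (e117.symm i) (e117.symm j)

/-- The integer lists encode `2^40·(r ζᵀ)` on the flat index. [folklore] -/
theorem rankOne_spec : ∀ a b : Fin 39 ⊕ (Fin 39 ⊕ Fin 39),
    (((vecOfList 117 rZ (e117 a) * vecOfList 117 zZ (e117 b) : ℤ)) : ℚ) = 1099511627776 * Matrix.vecMulVec rotVecQ zetaQ a b := by decide +kernel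

/-- **The exact deflated Jacobian `J′ = jacQx + r ζᵀ`, flattened — an EXPRESSION.** [folklore] -/
def defl117JQ : Matrix (Fin 117) (Fin 117) ℚ := fun i j => (droopQV.jacQx + Matrix.vecMulVec rotVecQ zetaQ) (e117.symm i) (e117.symm j)

/-- `J′ = J + r ζᵀ` on the flat index. [folklore] -/
theorem defl117JQ_eq : defl117JQ = JflatQ + RQ := by ext i j; rfl

/-- **Bridge**: the real deflated Jacobian `jacDefl (θ*, V*) ζ` IS `defl117JQ`, cast and reindexed (no kernel evaluation). [folklore] -/
theorem droopQV_jacDefl_eq : droopQV.toMicrogrid.jacDefl droopQV.angleOf droopQV.Vstar zeta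
    = (defl117JQ.map ((↑) : ℚ → ℝ)).submatrix e117 e117 := by
  rw [DroopMicrogrid.jacDefl, droopQV.jacMatrix_eq droopQV_circle, droopQV.jacQ_eq_jacQx]
  ext a b
  simp only [defl117JQ, Matrix.add_apply, Matrix.vecMulVec_apply, Matrix.map_apply, Matrix.submatrix_apply, Equiv.symm_apply_apply]
  push_cast
  congr 1
  rcases a with i | i | i <;> rcases b with j | j | j <;> simp [DroopMicrogrid.rot, rotVecQ, zeta, zetaQ]

/-! ## §2 The Lyapunov matrix `S := L̃L̃ᵀ/2^40` — positive definite BY CONSTRUCTION -/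

/-- `L̃` is lower-triangular with nonzero diagonal (list check). [folklore] -/
theorem Lt_tri : triCheck 117 Lt = true := by decide +kernel

/-- Every row of `L̃` fits the `117`-window. [folklore] -/
theorem Lt_len : rowsLenLe 117 Lt = true := by decide +kernel

/-- `2^40·S = L̃L̃ᵀ` as an integer matrix (the kernel computes its rows inside the block checks of §3 only). [folklore] -/
def SZ : Matrix (Fin 117) (Fin 117) ℤ := matrixOfRows 117 117 (gramRowsLT 117 Lt)

/-- **`S`** `= L̃L̃ᵀ/2^40` (rational, flattened index). [folklore] -/
def SQ : Matrix (Fin 117) (Fin 117) ℚ := SZ.map fun z : ℤ => (z : ℚ) / (1048576 : ℚ) ^ 2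

/-- **`S ≻ 0`** — STRUCTURAL (triangular factor with nonzero diagonal), no certificate. CERTIFIED. [folklore] -/
theorem S_posDef : (SQ.map ((↑) : ℚ → ℝ)).PosDef := posDef_gramRowsLT_div Lt_tri Lt_len 1048576 (by norm_num)

/-- `SZ = M_L̃ · M_L̃ᵀ`. [folklore] -/
theorem SZ_eq : SZ = matrixOfRows 117 117 Lt * (matrixOfRows 117 117 Lt)ᵀ := matrixOfRows_gramRowsLT 117 Lt Lt_len

/-- `S` is symmetric. [folklore] -/
theorem SQ_transpose : SQᵀ = SQ := by
  rw [SQ, SZ_eq, ← Matrix.transpose_map, Matrix.transpose_mul, Matrix.transpose_transpose]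

/-! ## §3 The twenty LOCAL block checks: `|T_ℤ − 2^80·T̃| ≤ 2^79` and `Σ_j |(L̃L̃ᵀ)_ij| ≤ ρ_ℤ`, rows `6c ≤ i < 6c + 6` -/

/-- `T_ℤ = L̃L̃ᵀ·(J̃ + 2^40·1) + 2^40·(L̃L̃ᵀ r) ζᵀ = 2^80·T′_model` as INTEGER rows (sparse accumulation; evaluated blockwise). [folklore] -/
def TZrows : List (List ℤ) := tRowsSparse 117 rZ zZ (consDiag 117 1099511627776 Jt) (gramRowsLT 117 Lt)

/-- **The block checks** (`b = 2^79`, `σ = 2^80`, `ρ_ℤ = 899305659333324796000`, width `6`, twenty blocks; each one `decide +kernel` in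
`Models/NE39SP39DroopQVDeflateBlocks{1,…,5}.lean`, collected here by definitional unfolding of `TZrows`). [folklore] -/
theorem blocks : ∀ c : Fin 20, blockCheckZ 117 604462909807314587353088 1208925819614629174706176 899305659333324796000
    (c.val * 6) 6 TZrows Ttw (gramRowsLT 117 Lt) = true := by
  intro c
  match c with
  | ⟨0, _⟩ => exact block0
  | ⟨1, _⟩ => exact block1
  | ⟨2, _⟩ => exact block2
  | ⟨3, _⟩ => exact block3
  | ⟨4, _⟩ => exact block4
  | ⟨5, _⟩ => exact block5
  | ⟨6, _⟩ => exact block6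
  | ⟨7, _⟩ => exact block7
  | ⟨8, _⟩ => exact block8
  | ⟨9, _⟩ => exact block9
  | ⟨10, _⟩ => exact block10
  | ⟨11, _⟩ => exact block11
  | ⟨12, _⟩ => exact block12
  | ⟨13, _⟩ => exact block13
  | ⟨14, _⟩ => exact block14
  | ⟨15, _⟩ => exact block15
  | ⟨16, _⟩ => exact block16
  | ⟨17, _⟩ => exact block17
  | ⟨18, _⟩ => exact block18
  | ⟨19, _⟩ => exact block19
  | ⟨k + 20, hk⟩ => exact absurd hk (by omega)

/-- Row facts from the blocks: closeness of `T_ℤ` to `2^80·T̃` and the row sums of `L̃L̃ᵀ`. [folklore] -/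
theorem row_facts (i : Fin 117) :
    (∀ j : Fin 117, |matrixOfRows 117 117 TZrows i j - 1208925819614629174706176 * matrixOfRows 117 117 Ttw i j| ≤ (604462909807314587353088 : ℤ))
      ∧ ∑ j : Fin 117, |SZ i j| ≤ (899305659333324796000 : ℤ) :=
  of_blockCheckZ_ranges blocks (by norm_num) i

/-! ## §4 `T′ = S·(J′ + 1)` EXACT vs the twin: `|T′ − T̃| ≤ 1`; `H = −(T′ + T′ᵀ)`; `H − 1 ⪰ 0` by the symmetric integer twin -/

/-- `T′ = S·(J′ + 1)` (EXPRESSION). [folklore] -/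
def TpQ : Matrix (Fin 117) (Fin 117) ℚ := SQ * (defl117JQ + 1)
/-- `T′_model = S·(J̃/2^40 + 1 + r ζᵀ)` (EXPRESSION; equals `T_ℤ/2^80`). [folklore] -/
def TmQ : Matrix (Fin 117) (Fin 117) ℚ := SQ * (JtQ + 1 + RQ)
/-- The integer twin as a rational matrix. [folklore] -/
def TtwQ : Matrix (Fin 117) (Fin 117) ℚ := fun i j => ((matrixOfRows 117 117 Ttw i j : ℤ) : ℚ)
/-- `T_ℤ = 2^80·T′_model` entrywise (semantics of the integer accumulation). [folklore] -/
theorem TZ_eq (i j : Fin 117) : ((matrixOfRows 117 117 TZrows i j : ℤ) : ℚ) = 1208925819614629174706176 * TmQ i j := by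
  rw [TZrows, matrixOfRows_tRowsSparse, matrixOfSparseRows_consDiag]
  have hr : ∀ k : Fin 117, (((vecOfList 117 rZ k * vecOfList 117 zZ j : ℤ)) : ℚ) = 1099511627776 * RQ k j := by
    intro k
    have h := rankOne_spec (e117.symm k) (e117.symm j)
    simpa only [RQ, Equiv.apply_symm_apply] using h
  simp only [TmQ, SQ, SZ, JtQ, Matrix.mul_apply, Matrix.add_apply, Matrix.map_apply, Matrix.smul_apply, Matrix.one_apply,
    Matrix.vecMulVec_apply, smul_eq_mul, Int.cast_sum, Finset.mul_sum]
  refine Finset.sum_congr rfl fun k _ => ?_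
  have hk := hr k
  push_cast at hk ⊢
  rw [mul_add, mul_add, hk]
  split_ifs <;> ring

/-- `|T′_model − T̃| ≤ 1/2`. [folklore] -/
theorem TmQ_close (i j : Fin 117) : |TmQ i j - TtwQ i j| ≤ 1 / 2 := by
  have h := (row_facts i).1 j
  have hq : |((matrixOfRows 117 117 TZrows i j : ℤ) : ℚ) - 1208925819614629174706176 * TtwQ i j| ≤ 604462909807314587353088 := by
    simp only [TtwQ]; exact_mod_cast h
  rw [TZ_eq] at hq
  rw [abs_le] at hq ⊢
  constructor <;> nlinarith [hq.1, hq.2]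

/-- `T′ − T′_model = S·(J − J̃/2^40)`. [folklore] -/
theorem TpQ_sub_TmQ : TpQ - TmQ = SQ * JflatQ - SQ * JtQ := by
  have h : (JflatQ + RQ + 1) - (JtQ + 1 + RQ) = JflatQ - JtQ := by abel
  rw [TpQ, TmQ, defl117JQ_eq, ← Matrix.mul_sub, h, Matrix.mul_sub]

/-- Row absolute sums of `S`: `Σ_k |S_ik| ≤ ρ_ℤ/2^40`. [folklore] -/
theorem SQ_rowAbs (i : Fin 117) : ∑ k, |SQ i k| ≤ (899305659333324796000 : ℚ) / 1099511627776 := by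
  have h := (row_facts i).2
  have hq : ∑ k : Fin 117, |((SZ i k : ℤ) : ℚ)| ≤ (899305659333324796000 : ℚ) := by
    have : ((∑ k : Fin 117, |SZ i k| : ℤ) : ℚ) ≤ ((899305659333324796000 : ℤ) : ℚ) := by exact_mod_cast h
    simpa [Int.cast_sum, Int.cast_abs] using this
  have hS : ∀ k, |SQ i k| = |((SZ i k : ℤ) : ℚ)| / 1099511627776 := by
    intro k
    simp only [SQ, Matrix.map_apply, abs_div]
    norm_num
  simp only [hS, ← Finset.sum_div]
  exact div_le_div_of_nonneg_right hq (by norm_num)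

/-- **`|T′ − T̃| ≤ 1`** entrywise (`1/2` rounding + `ρ_ℤ/2^81` model defect). CERTIFIED. [folklore] -/
theorem TpQ_close (i j : Fin 117) : |TpQ i j - TtwQ i j| ≤ 1 := by
  have h1 : |TpQ i j - TmQ i j| ≤ (899305659333324796000 : ℚ) / 1099511627776 * ((1 : ℚ) / 2199023255552) := by
    have := abs_mul_sub_mul_le (S := SQ) (A := JflatQ) (B := JtQ) SQ_rowAbs Jt_close (by norm_num) i j
    have hsub : TpQ i j - TmQ i j = (SQ * JflatQ) i j - (SQ * JtQ) i j := by
      have := congr_fun (congr_fun TpQ_sub_TmQ i) j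
      simpa [Matrix.sub_apply] using this
    rw [hsub]; exact this
  have h2 := TmQ_close i j
  calc |TpQ i j - TtwQ i j| = |(TpQ i j - TmQ i j) + (TmQ i j - TtwQ i j)| := by ring_nf
    _ ≤ |TpQ i j - TmQ i j| + |TmQ i j - TtwQ i j| := abs_add_le _ _
    _ ≤ (899305659333324796000 : ℚ) / 1099511627776 * ((1 : ℚ) / 2199023255552) + 1 / 2 := add_le_add h1 h2
    _ ≤ 1 := by norm_num

/-- `H(J′) = S·(−J′) + (S·(−J′))ᵀ − 2r₀·S`, `r₀ = 1` (EXPRESSION for the deflation theorem). [folklore] -/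
def HQ : Matrix (Fin 117) (Fin 117) ℚ := SQ * (-defl117JQ) + (SQ * (-defl117JQ))ᵀ - (2 : ℚ) • SQ

/-- `H = −(T′ + T′ᵀ)`. [folklore] -/
theorem HQ_eq : HQ = -(TpQ + TpQᵀ) := by
  rw [HQ, TpQ, Matrix.mul_add, Matrix.mul_one, Matrix.transpose_add, SQ_transpose, Matrix.mul_neg, Matrix.transpose_neg, two_smul]
  abel

/-- `H(J′)` is symmetric. [folklore] -/
theorem HQ_transpose : HQᵀ = HQ := by rw [HQ_eq, Matrix.transpose_neg, Matrix.transpose_add, Matrix.transpose_transpose, add_comm]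

/-- The symmetric integer twin `M = −(T̃ + T̃ᵀ) − 235·1` (COMPUTED from `Ttw`). [folklore] -/
def Mrows : List (List ℤ) := twinHRows 117 235 Ttw

/-- `M` is symmetric (list check on the computed rows). [folklore] -/
theorem Mrows_sym : PSD.symCheckZ 117 Mrows = true := by decide +kernel

/-- `M` is diagonally dominant: every row passes the zero-factor residual check. [folklore] -/
theorem Mrows_dom : ∀ i : Fin 117, PSD.rowCheckZ 117 1 Mrows ([] : List ℕ) ([] : List (List ℤ)) i.val = true := by decide +kernel

/-- `M` passes the TRIVIAL integer Gram check (zero factor): `M` is symmetric diagonally dominant (margin ≥ 1296). [folklore] -/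
theorem Mrows_gramCertZ : PSD.IsGramCertZ (matrixOfRows 117 117 Mrows) (vecOfList 1 ([] : List ℕ)) (matrixOfCols 1 117 ([] : List (List ℤ))) :=
  PSD.IsGramCertZ.of_listCheck' Mrows_sym Mrows_dom

/-- A row presentation of `H − 1·1` (never evaluated by the kernel). [folklore] -/
def Qrows : List (List ℚ) := (List.finRange 117).map fun i : Fin 117 => (List.finRange 117).map fun j : Fin 117 =>
  (HQ - (1 : ℚ) • (1 : Matrix (Fin 117) (Fin 117) ℚ)) i j

/-- `matrixOfRows Qrows = H − 1·1`. [folklore] -/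
theorem Qrows_eq : matrixOfRows 117 117 Qrows = HQ - (1 : ℚ) • (1 : Matrix (Fin 117) (Fin 117) ℚ) := by
  ext i j; rw [matrixOfRows_apply, Qrows, getD_map_finRange, getD_map_finRange]

/-- **Twin closeness** `|(H − 1) − (M + 234·1)| ≤ 2` entrywise (from `|T′ − T̃| ≤ 1` twice). [folklore] -/
theorem twin_close (i j : Fin 117) :
    |(1 : ℚ) * matrixOfRows 117 117 Qrows i j - (((matrixOfRows 117 117 Mrows i j : ℤ) : ℚ) + if i = j then ((234 : ℕ) : ℚ) else 0)| ≤ (2 : ℕ) := by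
  rw [Qrows_eq, Mrows, matrixOfRows_twinHRows, HQ_eq]
  have h1 := TpQ_close i j
  have h2 := TpQ_close j i
  simp only [TtwQ] at h1 h2
  simp only [Matrix.sub_apply, Matrix.neg_apply, Matrix.add_apply, Matrix.transpose_apply, Matrix.smul_apply, Matrix.one_apply,
    smul_eq_mul, mul_ite, mul_one, mul_zero, one_mul, Int.cast_sub, Int.cast_neg, Int.cast_add, Int.cast_ite, Int.cast_ofNat,
    Int.cast_zero, Nat.cast_ofNat]
  rw [abs_le] at h1 h2 ⊢
  constructor <;> split_ifs <;> nlinarith [h1.1, h1.2, h2.1, h2.2]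

/-- **`H − 1·1 ⪰ 0`** (rounded twin, trivial factor, margin `117·2 ≤ 234`). CERTIFIED. [folklore] -/
theorem Hshift_posSemidef : ((HQ - (1 : ℚ) • (1 : Matrix (Fin 117) (Fin 117) ℚ)).map ((↑) : ℚ → ℝ)).PosSemidef := by
  have hC := PSD.quadForm_nonneg_of_roundedTwin_of_close (R := ℝ) (S := 1) (s := 234) (e := 2) Mrows_gramCertZ (by norm_num) twin_close (by norm_num)
  refine Matrix.PosSemidef.of_dotProduct_mulVec_nonneg ?_ fun x => ?_
  · rw [Matrix.IsHermitian, Matrix.conjTranspose_eq_transpose_of_trivial]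
    have hT : (HQ - (1 : ℚ) • (1 : Matrix (Fin 117) (Fin 117) ℚ))ᵀ = HQ - (1 : ℚ) • (1 : Matrix (Fin 117) (Fin 117) ℚ) := by
      rw [Matrix.transpose_sub, HQ_transpose, Matrix.transpose_smul, Matrix.transpose_one]
    ext i j
    simp only [Matrix.transpose_apply, Matrix.map_apply]
    have h := congr_fun (congr_fun hT i) j
    rw [Matrix.transpose_apply] at h
    rw [h]
  · have h1 := hC x
    simp only [star_trivial]
    rw [← Qrows_eq]
    convert h1 using 1
    simp only [dotProduct, Matrix.mulVec, Matrix.map_apply, Finset.mul_sum, mul_assoc]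

/-- **`H(J′) ≻ 0`** (flattened). CERTIFIED. [folklore] -/
theorem H_posDef : (HQ.map ((↑) : ℚ → ℝ)).PosDef := by
  refine posDef_of_posSemidef_sub_smul_one (ε := (((1 : ℚ)) : ℝ)) (by norm_num) ?_
  rw [← NE39.map_sub_smul_one]
  exact Hshift_posSemidef

/-! ## §5 Transport to the state index and the certified statements -/

/-- The Lyapunov matrix on the state index. [folklore] -/
def S117 : Matrix (Fin 39 ⊕ (Fin 39 ⊕ Fin 39)) (Fin 39 ⊕ (Fin 39 ⊕ Fin 39)) ℝ := (SQ.map ((↑) : ℚ → ℝ)).submatrix e117 e117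
/-- `S ≻ 0` on the state index. [folklore] -/
theorem S117_posDef : S117.PosDef := S_posDef.submatrix e117.injective

/-- The certificate matrix on the state index IS the flattened `H(J′)`, reindexed; hence positive definite. [folklore] -/
theorem H117_posDef : (S117 * (-droopQV.toMicrogrid.jacDefl droopQV.angleOf droopQV.Vstar zeta)
    + (S117 * (-droopQV.toMicrogrid.jacDefl droopQV.angleOf droopQV.Vstar zeta))ᵀ
    - (2 * (1 : ℝ)) • S117).PosDef := by
  have hmat : S117 * (-droopQV.toMicrogrid.jacDefl droopQV.angleOf droopQV.Vstar zeta)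
      + (S117 * (-droopQV.toMicrogrid.jacDefl droopQV.angleOf droopQV.Vstar zeta))ᵀ
      - (2 * (1 : ℝ)) • S117
      = (HQ.map ((↑) : ℚ → ℝ)).submatrix e117 e117 := by
    rw [droopQV_jacDefl_eq, S117]
    ext a b
    simp only [HQ, Matrix.add_apply, Matrix.sub_apply, Matrix.smul_apply, Matrix.mul_apply, Matrix.transpose_apply,
      Matrix.neg_apply, Matrix.submatrix_apply, Matrix.map_apply, smul_eq_mul]
    rw [e117.sum_comp (fun k => ((SQ (e117 a) k : ℚ) : ℝ) * -((defl117JQ k (e117 b) : ℚ) : ℝ)),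
      e117.sum_comp (fun k => ((SQ (e117 b) k : ℚ) : ℝ) * -((defl117JQ k (e117 a) : ℚ) : ℝ))]
    push_cast
    ring
  rw [hmat]
  exact H_posDef.submatrix e117.injective

/-- `γ = Σ ζ_k r_k = −39 < −r₀ = −1`. [folklore] -/
theorem zeta_gamma : ∑ k, zeta k * DroopMicrogrid.rot k < -(1 : ℝ) := by
  rw [Fintype.sum_sum_type, Fintype.sum_sum_type]; simp [zeta, DroopMicrogrid.rot]

/-- **CERTIFIED RATE at `117` states (★ candidate #108-cand «G3.b-ss-DROOPQV-NE39SP39-RATE»).** Every complex eigenpair `(z, v)` of the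
`117 × 117` linearisation `jacMatrix (θ*, V*)` of MODEL `NE39SP39.droopQV.toMicrogrid` (the DROOPQV-NE39SP39 CONSTRUCTION, MV-6N synthetic on the
printed New England branch reactances; `G = 0`, no shunts, no loads) at its exact rest point is the ROTATION MODE (`z = 0`, `v ∈ ℂ·r`) or has
`Re z < −1`. CERTIFIED (matrix statement); MODELLED: construction [cite: KunduEtAl2019, eqs. (4a)–(4c)] [cite: Padiyar2013, App. D] — never the
New England system, never a region, never «stable». -/
theorem droopQV_eig_re_lt {z : ℂ} {v : Fin 39 ⊕ (Fin 39 ⊕ Fin 39) → ℂ} (hv : v ≠ 0)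
    (hJ : (droopQV.toMicrogrid.jacMatrix droopQV.angleOf droopQV.Vstar).map ((↑) : ℝ → ℂ) *ᵥ v = z • v) :
    (z = 0 ∧ ∃ a : ℂ, v = fun k => a * (DroopMicrogrid.rot k : ℂ)) ∨ z.re < -1 :=
  droopQV.toMicrogrid.eig_re_lt_neg_of_deflate _ _ zeta (by norm_num) zeta_gamma S117_posDef H117_posDef hv hJ

/-- **No Jordan chain at the rotation zero** (with `droopQV_eig_re_lt`: the eigenvalue `0` of the `117 × 117` Jacobian is ALGEBRAICALLY SIMPLE).
CERTIFIED (matrix statement about the MODEL); no stability sentence. [folklore] -/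
theorem droopQV_no_jordan_chain_at_zero {w : Fin 39 ⊕ (Fin 39 ⊕ Fin 39) → ℂ}
    (hw : (droopQV.toMicrogrid.jacMatrix droopQV.angleOf droopQV.Vstar).map ((↑) : ℝ → ℂ) *ᵥ w
      = fun k => ((DroopMicrogrid.rot k : ℝ) : ℂ)) : False :=
  droopQV.toMicrogrid.no_jordan_chain_at_zero_of_deflate _ _ zeta (by norm_num) zeta_gamma S117_posDef H117_posDef hw

end NE39SP39

end Summit.Ventures.GridStability.Models

end
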